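import Summits.KontsevichZagierPeriods.KontsevichZagierPeriods.Theorems.LinRedNormalFormArrangementNormalFormStubUnletterDissection

/-!
# `ArrangementNormalForm` (stmt-KontsevichZagierPeriods-3915), line `janus-bands`, stub `stub_unletter` — the stub

Support file for `stub_unletter` (Janus band representations of base dimension `0` are congruent,
modulo `KZ.relations`, to `ℤ`-combinations of LETTERED ORDER CELLS).  The normal form of the whole
argument is a representation on the open ordered simplex
`Δ_w = KZ.openOrderedSimplex w = {1 > t₀ > ⋯ > t_{w-1} > 0}` with integrand
`cint G a t = G(t) · ∏ᵢ lett (a i) (tᵢ)` (`G` a polynomial over `ℚ`, `a i : Option ℚ` an optional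
simple constant letter, `lett (some c) x = 1/(x - c)`, `lett none x = 1`); the letters are ADMISSIBLE
(`Adm`) when none lies in `(0, 1)`, the top coordinate `t₀` is not lettered `1` and the bottom
coordinate `t_{w-1}` is not lettered `0`.  All helper declarations live in the sub-namespace
`…JanusBands.Unletter`.

This file: Janus band representations of base dimension `0` are bounded lettered order cells after
transport along `0 + k = k` (`janusZero_mem_RS`), and the registered stub `stub_unletter` (its output
`Jw` is consumed by `stub_words` of the same line).

References: M. Kontsevich, D. Zagier, *Periods* (2001), §1.2; D. Zagier, *Values of zeta functions
and their applications* (1994), §9 (convergence of iterated integrals).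
-/

noncomputable section

open Set MeasureTheory MvPolynomial
open Literature.NumberTheory.Transcendental
open Literature.ModelTheory.ExponentialFields (IsSemialgebraic)

namespace Summit.KontsevichZagierPeriods.ArrangementNormalForm.JanusBands

namespace Unletter

/-! ## Part D: Janus band representations of base dimension `0` -/

/-- Transport does not change the generator. -/
theorem of_castRep {a b : ℕ} (h : a = b) (s : KZ.IntegralRep a) : KZ.of (castRep h s) = KZ.of s := by
  subst h; rfl

/-- The domain of a transported representation. -/
theorem castRep_domain {a b : ℕ} (h : a = b) (s : KZ.IntegralRep a) :
    (castRep h s).domain = {z | (fun i => z (Fin.cast h i)) ∈ s.domain} := by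
  subst h; rfl

/-- The integrand of a transported representation. -/
theorem castRep_integrand {a b : ℕ} (h : a = b) (s : KZ.IntegralRep a) (z : Fin b → ℝ) :
    (castRep h s).integrand z = s.integrand (fun i => z (Fin.cast h i)) := by
  subst h; rfl

/-- **Janus band representations of base dimension `0` lie in `RS`.** With no base coordinate the
polyhedral condition is a decidable constant (an empty domain is null), the rational part of the
integrand is a rational constant, letters and bounds are rational constants: after transport
`IntegralRep (0 + k) → IntegralRep k` this is a bounded lettered order cell (`orderCell_mem_RS`). -/
theorem janusZero_mem_RS {k m m' : ℕ} (s : KZ.IntegralRep (0 + k)) (M : Fin m' → (Fin 0 → ℚ) × ℚ)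
    (L : Fin m → (Fin 0 → ℚ) × ℚ) (e : Fin m → ℕ) (p : MvPolynomial (Fin 0) ℚ)
    (a : Fin k → Option ((Fin 0 → ℚ) × ℚ)) (lo hi : Fin k → Fin k ⊕ ((Fin 0 → ℚ) × ℚ))
    (hbd : Bornology.IsBounded s.domain)
    (hdom : s.domain = {z | (∀ j, 0 < ∑ i, ((M j).1 i : ℝ) * z (Fin.castAdd k i) + ((M j).2 : ℝ)) ∧
      ∀ i, Sum.elim (fun j => z (Fin.natAdd 0 j))
        (fun c => ∑ i', (c.1 i' : ℝ) * z (Fin.castAdd k i') + (c.2 : ℝ)) (lo i) < z (Fin.natAdd 0 i) ∧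
        z (Fin.natAdd 0 i) < Sum.elim (fun j => z (Fin.natAdd 0 j))
          (fun c => ∑ i', (c.1 i' : ℝ) * z (Fin.castAdd k i') + (c.2 : ℝ)) (hi i)})
    (hint : EqOn s.integrand (fun z => MvPolynomial.aeval (fun i => z (Fin.castAdd k i)) p /
      (∏ j, (∑ i, ((L j).1 i : ℝ) * z (Fin.castAdd k i) + ((L j).2 : ℝ)) ^ e j) *
      ∏ i, (a i).elim 1 (fun c => 1 / (z (Fin.natAdd 0 i) -
        (∑ i', (c.1 i' : ℝ) * z (Fin.castAdd k i') + (c.2 : ℝ))))) s.domain) :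
    KZ.of (castRep (Nat.zero_add k) s) ∈ RS := by
  classical
  set s' := castRep (Nat.zero_add k) s with hs'
  have hci : ∀ i : Fin k, Fin.cast (Nat.zero_add k) (Fin.natAdd 0 i) = i := fun i => Fin.ext (by simp)
  have hmem : ∀ z : Fin k → ℝ, z ∈ s'.domain ↔ (∀ j, (0 : ℚ) < (M j).2) ∧
      ∀ i, Sum.elim z (fun c : ℚ => (c : ℝ)) ((lo i).map id Prod.snd) < z i ∧
        z i < Sum.elim z (fun c : ℚ => (c : ℝ)) ((hi i).map id Prod.snd) := by
    intro z
    rw [hs', castRep_domain, hdom]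
    simp only [mem_setOf_eq, hci, Finset.univ_eq_empty, Finset.sum_empty, zero_add, Rat.cast_pos,
      Sum.elim_map, Function.comp_id]
    exact Iff.rfl
  by_cases hP : ∀ j, (0 : ℚ) < (M j).2
  · have hdom' : s'.domain = {z | ∀ i, Sum.elim z (fun c : ℚ => (c : ℝ)) ((lo i).map id Prod.snd) < z i ∧
        z i < Sum.elim z (fun c : ℚ => (c : ℝ)) ((hi i).map id Prod.snd)} := by
      ext z; rw [hmem]; simp [hP]
    have hbd' : Bornology.IsBounded s'.domain := by
      obtain ⟨C0, hC0⟩ := isBounded_iff_forall_norm_le.1 hbd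
      refine isBounded_iff_forall_norm_le.2 ⟨max C0 0, fun z hz => ?_⟩
      have hz' : (fun i => z (Fin.cast (Nat.zero_add k) i)) ∈ s.domain := by
        rw [hs', castRep_domain] at hz; exact hz
      refine (pi_norm_le_iff_of_nonneg (le_max_right _ _)).2 fun i => ?_
      have := (norm_le_pi_norm (fun i => z (Fin.cast (Nat.zero_add k) i)) (Fin.natAdd 0 i)).trans
        (hC0 _ hz')
      simp only [hci] at this
      exact this.trans (le_max_left _ _)
    have hint' : EqOn s'.integrand (fun z => ((coeff 0 p / ∏ j, (L j).2 ^ e j : ℚ) : ℝ) *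
        ∏ i, lett ((a i).map Prod.snd) (z i)) s'.domain := by
      intro z hz
      have hz' : (fun i => z (Fin.cast (Nat.zero_add k) i)) ∈ s.domain := by
        rw [hs', castRep_domain] at hz; exact hz
      rw [hs', castRep_integrand, hint hz']
      simp only [Finset.univ_eq_empty, Finset.sum_empty, zero_add, hci]
      rw [MvPolynomial.eq_C_of_isEmpty p, aeval_C, coeff_C]
      simp only [if_true, eq_ratCast]
      push_cast
      congr 1
      refine Finset.prod_congr rfl fun i _ => ?_
      cases a i <;> simp
    exact orderCell_mem_RS s' _ _ _ _ hbd' hdom' hint'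
  · refine mem_RS_of_mem_relations (KZ.of_mem_relations_of_volume_eq_zero s' ?_)
    have : s'.domain = ∅ := eq_empty_of_forall_notMem fun z hz => hP ((hmem z).1 hz).1
    rw [this, measure_empty]

end Unletter

open Unletter

/-- **stub_unletter** (line `janus-bands` of crux `ArrangementNormalForm`). Every Janus band
representation of base dimension `0` is congruent modulo `KZ.relations` to a `ℤ`-combination of
LETTERED ORDER CELLS. A base-`0` representation is (after transport) a bounded order cell with
rational constant bounds, optional simple constant letters and a rational constant factor
(`janusZero_mem_RS`); it is dissected into pattern pieces (rule 1a), each normalised by an affine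
change of variables onto the open ordered simplex (rule 2), where the letter-free coordinates are
integrated out one at a time by Newton–Leibniz moves with polynomial primitives (rule 3, `stepE`) and
the polynomial weights are split termwise into admissible — hence absolutely convergent — lettered
simplices (rule 1b, `stepS`); admissibility of the initial pieces is forced by their absolute
convergence (`adm_of_integrableOn`). -/
theorem stub_unletter (J : ℕ → Set KZ.FormalRep) (Jw : Set KZ.FormalRep) (hJ : ∀ b, J b = {w : KZ.FormalRep | ∃ (k m m' : ℕ) (s : KZ.IntegralRep (b + k)) (M : Fin m' → (Fin b → ℚ) × ℚ) (L : Fin m → (Fin b → ℚ) × ℚ) (e : Fin m → ℕ) (p : MvPolynomial (Fin b) ℚ) (a : Fin k → Option ((Fin b → ℚ) × ℚ)) (lo hi : Fin k → Fin k ⊕ ((Fin b → ℚ) × ℚ)), Bornology.IsBounded s.domain ∧ s.domain = {z | (∀ j, 0 < ∑ i, ((M j).1 i : ℝ) * z (Fin.castAdd k i) + ((M j).2 : ℝ)) ∧ ∀ i, Sum.elim (fun j => z (Fin.natAdd b j)) (fun c => ∑ i', (c.1 i' : ℝ) * z (Fin.castAdd k i') + (c.2 : ℝ)) (lo i) < z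 (Fin.natAdd b i) ∧ z (Fin.natAdd b i) < Sum.elim (fun j => z (Fin.natAdd b j)) (fun c => ∑ i', (c.1 i' : ℝ) * z (Fin.castAdd k i') + (c.2 : ℝ)) (hi i)} ∧ EqOn s.integrand (fun z => MvPolynomial.aeval (fun i => z (Fin.castAdd k i)) p / (∏ j, (∑ i, ((L j).1 i : ℝ) * z (Fin.castAdd k i) + ((L j).2 : ℝ)) ^ e j) * ∏ i, (a i).elim 1 (fun c => 1 / (z (Fin.natAdd b i) - (∑ i', (c.1 i' : ℝ) * z (Fin.castAdd k i') + (c.2 : ℝ))))) s.domain ∧ w = KZ.of s}) (hJw : Jw = {w : KZ.FormalRep | ∃ (k : ℕ) (s : KZ.IntegralRep k) (q : ℚ) (a : Fin k → ℚ) (lo hi : Fin k → Fin k ⊕ ℚ), Bornology.IsBounded s.domain ∧ s.domain = {z | ∀ i, Sum.elim z (fun c => (c : ℝ)) (lo i) < z i ∧ z i < Sum.elim z (fun c => (c : ℝ)) (hi i)} ∧ EqOn s.integrand (fun z => (q : ℝ) * ∏ i, 1 / (z i - (a i : ℝ))) s.domain ∧ w = KZ.of s}) : ∀ x ∈ J 0,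 ∃ c ∈ AddSubgroup.closure Jw, x - c ∈ KZ.relations := by
  intro x hx
  rw [hJ] at hx
  obtain ⟨k, m, m', s, M, L, e, p, a, lo, hi, hbd, hdom, hint, rfl⟩ := hx
  subst hJw
  rw [← of_castRep (Nat.zero_add k) s]
  exact mem_RS_iff.1 (janusZero_mem_RS s M L e p a lo hi hbd hdom hint)

end Summit.KontsevichZagierPeriods.ArrangementNormalForm.JanusBands
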